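import Literature.MathematicalPhysics.QuantumFieldTheory.Balaban1983to89.HaarDensityOrthogonalGlobal
import Literature.MathematicalPhysics.QuantumFieldTheory.Balaban1983to89.HaarDensitySymplecticChart
import Literature.MathematicalPhysics.QuantumFieldTheory.Balaban1983to89.SymplecticLogChartTwinBridge
import Literature.LinearAlgebra.Matrix.CompactSymplecticGroupConjugacy

/-!
# `Balaban1983to89.HaarDensitySymplecticGlobal` — THE HAAR MEASURE OF THE COMPACT SYMPLECTIC GROUP `Sp(n) = U(2n) ∩
# Sp(2n, ℂ)` IN EXPONENTIAL COORDINATES, GLOBALLY, ON THE MAXIMAL BALL `Ω = {A ∈ 𝔰𝔭(n) : ‖A‖ < π}`: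
# `∫_{Sp(n)} F dμ = σ₀ ∫_Ω F(e^A) Π_{{j,k}} sinc((θ_j(A)+θ_k(A))/2) dη(A)`, `σ₀ = μ(Sp(n))/∫_Ω Π_{{j,k}} sinc dη`

statement-level skeleton of published theorems with citation tags; proofs where landed; nothing here is a claim
about the Yang–Mills mass gap

Mega-formalization `lit-balaban` (HOME `run/shared/lean/pub/lit-balaban/`), unit `lit-balaban-p28` gen 16 (Phase-2
proof seat; free-target protocol G.5-34(d), TAKING 2026-08-23T11:03Z).  File 5 of 5; the `Sp(n)` twin of file 4
`HaarDensityOrthogonalGlobal`.  Gen 12's `HaarDensitySymplecticChart` gave [Balaban1985UV3] p. 260 for the compact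
symplectic group `symplecticSubgroup J ≤ U(m)` (`uᵀJu = J`) on the small windows `V_s`; THIS FILE gives it on the
whole group for Mathlib's `J = Matrix.J l ℂ = [[0, −1], [1, 0]]` on `l ⊕ l` (`Sp(n)`, `n = |l|`): (a) `Sp(n)` is
CONNECTED — every element is conjugate into the torus `Tⁿ` (the tree's `iUnion_conj_symplecticTorus`, [BtD] IV (1.6)/
(1.7)/(3.7) for `Sp(n)`, read through r20's bridge `SymplecticLogChartTwinBridge`), so by file 2 its exponential chart
is onto and by file 3 `μ{u ∈ Sp(n) : −1 ∈ σ(u)} = 0`; (b) THE PRINCIPAL LOGARITHM OF A SYMPLECTIC UNITARY IS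
SYMPLECTIC: for `u ∈ Sp(n)` with `‖u − 1‖ < 2` and `X ∈ 𝔲(2n)`, `‖X‖ < π`, `e^X = u`, also `Y = −J⁻¹XᵀJ ∈ 𝔲(2n)` has
`‖Y‖ = ‖X‖` (file 4's spectral lemma) and `e^Y = J⁻¹((e^X)ᵀ)⁻¹J = J⁻¹(uᵀ)⁻¹J = u`, so `Y = X`, i.e. `XᵀJ = −JX`,
`X ∈ 𝔰𝔭(n)`; hence `Θ({‖A‖ < π} ∩ 𝔰𝔭(n)) = {u ∈ Sp(n) : ‖u − 1‖ < 2}` has FULL Haar measure; (c) gen 13's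
`IsChartRep.lintegral_haar_eq_of_null` + gen 12's explicit density `jacDensity_symplectic_J_eq_of_diag` BY NAME.
SKELETON rows served (SUPPORT cells only, no head change): B10.Eq21 / display E18 ([Balaban1985UV3] (18)/(21)
pp. 260–261, owner r07), B13.Eq1.37 (r10), B12.Eq2.10–2.12 (r09/r20).

CITATION HEADER.  [Balaban1985UV3] T. Bałaban, CMP **102** (1985) 255–275, p. 260: *«dU′ = σ(A′)dA′ = σ₀ σ/σ₀ (A′)dA′,
σ₀ = σ(0) … σ(A′) is a density which can be calculated explicitly for all classical groups»*.  [Helgason2000] Ch. I §1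
**Thm. 1.14** (13) p. 96 (quoted in file 4) — here `G = Sp(n)`, `N₀ = {A ∈ 𝔰𝔭(n) : ‖A‖ < π}`, `N_e = {u : −1 ∉ σ(u)}`,
`Sp(n) ∖ N_e` NULL.  [Balaban1985Averaging] CMP **98** (1985) (22)–(24) p. 21 (principal logarithm of a unitary matrix,
`|A| ≤ π`, operator norm = largest |eigenvalue|).  [BrockerTomDieck1985] IV (1.6)/(1.7) (conjugates of a maximal torus
cover `G`), IV (2.2) (exp surjective), IV (3.7) (`Tⁿ ⊂ Sp(n)`); tree: `Literature/LinearAlgebra/Matrix/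
CompactSymplecticGroupConjugacy`, `…WeylGroup`.  [Sepanski2007] §1.1.4.3 (1.14) (`Sp(n) ≅ U(2n) ∩ Sp(n, ℂ)`,
`J = [[0, −I], [I, 0]]`), §6.1.5.2 (type `C_n`).

WHAT IS PROVED (theorems only; 0 definitions, 0 named facts, 0 sorry; axioms standard).  `Sp = symplecticSubgroup
(Matrix.J l ℂ) ≤ U(2n)` (gen 12), `𝓛 = unitarySubgroupLogChart Sp _` (Lie algebra `symplecticLie J`, gen 12), `Θ` its
chart, `L²`-operator norm.
* §1 **`isConnected_symplecticSubgroup`** (`Sp(n) ≤ U(2n)` is connected: the image of p24's `compactSymplecticGroup l`,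
  which is the union of the conjugates of the connected torus `Tⁿ`), `expChart_symplectic_surjective` (file 2),
  `haar_symplectic_neg_one_mem_spectrum_eq_zero` (file 3).
* §2 (`star_J_mul_J`, `J_mul_star_J` from the tree's `star_J`) **`transpose_mul_J_eq_neg_of_exp_eq`** (the principal logarithm of `u ∈ Sp(n)`, `‖u − 1‖ < 2`, satisfies
  `XᵀJ = −JX`), **`image_expChart_ball_pi_eq`: `Θ({A ∈ 𝔰𝔭(n) : ‖A‖ < π}) = {u ∈ Sp(n) : ‖u − 1‖ < 2}`**,
  **`haar_compl_image_ball_pi_eq_zero`** (full Haar measure).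
* §3 THE GLOBAL FORMULA for every Haar `μ` on `Sp(n)` and every additive Haar `η` on `𝔰𝔭(n)`:
  `haar_symplectic_eq_smul_chartMeasureOn`, `windowConst_symplectic_eq`, **`lintegral_haar_symplectic_eq`**,
  `haar_symplectic_apply_eq`, and with the explicit density **`lintegral_haar_symplectic_eq_prod_sinc_of_diag` /
  `…_eq_prod_sinc`: `∫_{Sp(n)} F dμ = σ₀ ∫_{‖A‖<π} F(e^A) Π_{{j,k}} sinc((θ_j(A) + θ_k(A))/2) dη(A)`,
  `σ₀ = μ(Sp(n))/∫_{‖A‖<π} Π_{{j,k}} sinc dη`** (unordered pairs with repetition; `θ(A)` = eigenvalues of `−iA`),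
  `lintegral_haarProbability_symplectic_eq_prod_sinc`.

HONEST SCOPE.  (i) `J = Matrix.J l ℂ` only (gen 12's chart is for every `J` with `Jᵀ = −J`, `J² = −1`, `J` real; the
connectedness input is available in the tree for Mathlib's `J`); `Sp(n)` realised inside `U(2n)` as in gen 12, no
quaternionic model.  (ii) `σ₀` identified (`μ(Sp(n))/∫_{B_π} ρ dη`), not evaluated.  (iii) Nothing of gens 8–14,
files 1–4, r20's bridge, p24's `CompactSymplecticGroup*` or Mathlib is re-proved.  Failed printed steps: none
(HOME/GAPS.md unchanged).
-/

noncomputable section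

open NormedSpace Set Function Filter Topology MeasureTheory Complex Matrix
open scoped ENNReal NNReal Matrix.Norms.L2Operator ComplexConjugate

namespace Literature.MathematicalPhysics.QuantumFieldTheory.Balaban1983to89.HaarDensitySymplecticGlobal

open HaarExponentialChart HaarExponentialChart.IsChartRep HaarDensityUnitaryGlobal HaarDensitySymplecticChart
open HaarDensityUnitaryExplicit (isHermitian_neg_I_smul)
open HaarDensityOrthogonalExplicit (eq_unitary_mul_diagonal_mul_star)
open HaarDensitySymplecticExplicit (symplecticLie mem_symplecticLie_iff)
open Literature.LinearAlgebra.AdEigenvaluesSymplectic (pairSum)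
open LogChartClosedSubgroup (unitarySubgroupLogChart)
open HaarSmallBallClosedSubgroup (compactSpace_of_isClosed_subgroup)
open HaarNegOneEigenvalueNull (ae_norm_sub_one_lt_two haar_setOf_neg_one_mem_spectrum_eq_zero)
open ExpSurjectiveConnectedSubgroup (expChart_surjective)
open HaarDensityOrthogonalGlobal (norm_eq_of_spectrum_eq_of_skewHermitian spectrum_transpose spectrum_units_conj
  norm_transpose_of_skewHermitian)
open SymplecticLogChartTwinBridge (mem_symplecticSubgroup_J_iff)
open Literature.LinearAlgebra.Matrix (compactSymplecticGroup mem_compactSymplecticGroup_iff iUnion_conj_symplecticTorus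
  isConnected_symplecticTorus)
open Literature.MathematicalPhysics.QuantumLattice (unitaryFundamentalRep unitaryFundamentalRep_apply)

variable {l : Type*} [Fintype l] [DecidableEq l]

/-! ## §1 `Sp(n) ≤ U(2n)` is connected; its exponential chart is onto; `{−1 ∈ σ}` is Haar-null -/

section Connected

/-- The inclusion of p24's `compactSymplecticGroup l = U(2n) ⊓ Sp(2n, ℂ)` (a submonoid of `M_{2n}(ℂ)`) into `U(2n)`
has range gen 12's `symplecticSubgroup (Matrix.J l ℂ)` (r20's `mem_symplecticSubgroup_J_iff`).
[cite: Sepanski2007, §1.1.4.3 (1.14)] [cite: BrockerTomDieck1985, IV (3.7)] -/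
theorem range_inclusion_compactSymplecticGroup_eq :
    Set.range (fun X : compactSymplecticGroup l =>
        (⟨(X : Matrix (l ⊕ l) (l ⊕ l) ℂ), (mem_compactSymplecticGroup_iff.1 X.2).1⟩ : Matrix.unitaryGroup (l ⊕ l) ℂ)) =
      (symplecticSubgroup (Matrix.J l ℂ) : Set (Matrix.unitaryGroup (l ⊕ l) ℂ)) := by
  ext u
  constructor
  · rintro ⟨X, rfl⟩
    exact mem_symplecticSubgroup_J_iff.2 (mem_compactSymplecticGroup_iff.1 X.2).2
  · intro hu
    exact ⟨⟨(u : Matrix (l ⊕ l) (l ⊕ l) ℂ), mem_compactSymplecticGroup_iff.2 ⟨u.2, mem_symplecticSubgroup_J_iff.1 hu⟩⟩,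
      Subtype.ext rfl⟩

/-- **`Sp(n)` is connected as a space** (p24's `compactSymplecticGroup l`): it is the union over `g` of the conjugates
`g Tⁿ g⁻¹` of the connected torus `Tⁿ`, all containing `1` ([BtD] IV (1.6)/(1.7) for `Sp(n)`, the tree's
`iUnion_conj_symplecticTorus`, `isConnected_symplecticTorus`). [cite: BrockerTomDieck1985, IV (1.6), (1.7), (3.7)] -/
theorem connectedSpace_compactSymplecticGroup : ConnectedSpace (compactSymplecticGroup l) := by
  rw [connectedSpace_iff_univ, ← iUnion_conj_symplecticTorus]
  refine ⟨⟨1, Set.mem_iUnion.2 ⟨1, 1, (Literature.LinearAlgebra.Matrix.symplecticTorus l).one_mem, by simp⟩⟩,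
    isPreconnected_iUnion ⟨1, Set.mem_iInter.2 fun g => ⟨1, (Literature.LinearAlgebra.Matrix.symplecticTorus l).one_mem,
      by simp⟩⟩ fun g => ?_⟩
  exact (isConnected_symplecticTorus.image _
    ((continuous_const.mul continuous_id).mul continuous_const).continuousOn).isPreconnected

/-- **`Sp(n) ≤ U(2n)` IS CONNECTED** (continuous image of the connected `compactSymplecticGroup l`).
[cite: BrockerTomDieck1985, IV (1.6), (1.7), (3.7)] [cite: Sepanski2007, §1.1.4.3 (1.14)] -/
theorem isConnected_symplecticSubgroup :
    IsConnected (symplecticSubgroup (Matrix.J l ℂ) : Set (Matrix.unitaryGroup (l ⊕ l) ℂ)) := by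
  haveI := connectedSpace_compactSymplecticGroup (l := l)
  rw [← range_inclusion_compactSymplecticGroup_eq]
  exact isConnected_range (Continuous.subtype_mk continuous_subtype_val _)

/-- **THE EXPONENTIAL CHART OF `Sp(n)` IS ONTO** (file 2, [BtD] IV (2.2)). [cite: BrockerTomDieck1985, IV (2.2)] -/
theorem expChart_symplectic_surjective :
    Function.Surjective (isChartRep_unitarySubgroup (symplecticSubgroup (Matrix.J l ℂ)) isClosed_symplecticSubgroup).expChart :=
  expChart_surjective (symplecticSubgroup (Matrix.J l ℂ)) isClosed_symplecticSubgroup isConnected_symplecticSubgroup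

/-- **`μ{u ∈ Sp(n) : −1 ∈ σ(u)} = 0`** for every Haar measure `μ` on `Sp(n)` (file 3).
[cite: Helgason2000, Ch. I §1 Thm. 1.14 (13) p. 96] [cite: BrockerTomDieck1985, IV (2.2), (2.11)] -/
theorem haar_symplectic_neg_one_mem_spectrum_eq_zero (μ : Measure (symplecticSubgroup (Matrix.J l ℂ))) [μ.IsHaarMeasure] :
    μ {g : symplecticSubgroup (Matrix.J l ℂ) |
      (-1 : ℂ) ∈ spectrum ℂ (((g : symplecticSubgroup (Matrix.J l ℂ)) : Matrix.unitaryGroup (l ⊕ l) ℂ) : Matrix (l ⊕ l) (l ⊕ l) ℂ)}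
        = 0 :=
  haar_setOf_neg_one_mem_spectrum_eq_zero (symplecticSubgroup (Matrix.J l ℂ)) isClosed_symplecticSubgroup μ
    expChart_symplectic_surjective

end Connected

/-! ## §2 The principal logarithm of a symplectic unitary is symplectic: the image of the maximal ball, full measure -/

section Image

/-- `J* J = 1` (the tree's `star_J`: `J* = −J`, and `J² = −1`). [cite: Sepanski2007, §1.1.4.3 (1.14)] -/
theorem star_J_mul_J : star (Matrix.J l ℂ) * Matrix.J l ℂ = 1 := by
  rw [star_J, Matrix.neg_mul, Matrix.J_squared, neg_neg]

/-- `J J* = 1`. [cite: Sepanski2007, §1.1.4.3 (1.14)] -/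
theorem J_mul_star_J : Matrix.J l ℂ * star (Matrix.J l ℂ) = 1 := by
  rw [star_J, Matrix.mul_neg, Matrix.J_squared, neg_neg]

/-- **THE PRINCIPAL LOGARITHM OF A SYMPLECTIC UNITARY IS SYMPLECTIC**: if `X ∈ 𝔲(2n)`, `‖X‖ < π`, `e^X = u` with
`uᵀJu = J`, then `XᵀJ = −JX` — since `Y = J*(−Xᵀ)J ∈ 𝔲(2n)` has `‖Y‖ = ‖X‖ < π` (file 4's spectral lemma:
`σ(J*XᵀJ) = σ(Xᵀ) = σ(X)`) and `e^Y = J*((e^X)ᵀ)⁻¹J = J*(uᵀ)⁻¹J = u`, and the chart of `U(2n)` is injective on the ball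
`‖A‖ < π` (gen 13). [cite: Balaban1985Averaging, (22)–(23) p. 21] [cite: Sepanski2007, §1.1.4.3 (1.14), §6.1.5.2] -/
theorem transpose_mul_J_eq_neg_of_exp_eq {X : (unitaryLogChart (l ⊕ l)).lie} (hX : ‖X‖ < Real.pi)
    {u : Matrix (l ⊕ l) (l ⊕ l) ℂ} (hu : uᵀ * Matrix.J l ℂ * u = Matrix.J l ℂ) (huU : u ∈ Matrix.unitaryGroup (l ⊕ l) ℂ)
    (hXu : exp (X : Matrix (l ⊕ l) (l ⊕ l) ℂ) = u) :
    (X : Matrix (l ⊕ l) (l ⊕ l) ℂ)ᵀ * Matrix.J l ℂ = -(Matrix.J l ℂ * X) := by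
  set J : Matrix (l ⊕ l) (l ⊕ l) ℂ := Matrix.J l ℂ with hJdef
  have hXh : (X : Matrix (l ⊕ l) (l ⊕ l) ℂ)ᴴ = -X := by
    rw [← star_eq_conjTranspose]; exact mem_unitaryLogChart_lie.1 X.2
  have hXTh : (X : Matrix (l ⊕ l) (l ⊕ l) ℂ)ᵀᴴ = -(X : Matrix (l ⊕ l) (l ⊕ l) ℂ)ᵀ := by
    ext i j
    have hij := congrFun (congrFun hXh j) i
    simp only [conjTranspose_apply] at hij
    simp only [conjTranspose_apply, transpose_apply]
    exact hij
  -- the second logarithm `Y = −J* Xᵀ J`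
  set Y₀ : Matrix (l ⊕ l) (l ⊕ l) ℂ := -(star J * (X : Matrix (l ⊕ l) (l ⊕ l) ℂ)ᵀ * J) with hY₀
  have hstarXT : star ((X : Matrix (l ⊕ l) (l ⊕ l) ℂ)ᵀ) = -(X : Matrix (l ⊕ l) (l ⊕ l) ℂ)ᵀ := by
    rw [star_eq_conjTranspose, hXTh]
  have hYmem : Y₀ ∈ (unitaryLogChart (l ⊕ l)).lie := by
    rw [mem_unitaryLogChart_lie, hY₀, star_neg, star_mul, star_mul, star_star, hstarXT]
    simp only [Matrix.mul_neg, Matrix.neg_mul, neg_neg, Matrix.mul_assoc]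
  set Y : (unitaryLogChart (l ⊕ l)).lie := ⟨Y₀, hYmem⟩ with hYdef
  -- `‖Y‖ = ‖X‖`
  have hJunit : IsUnit (star J) := by
    rw [Matrix.isUnit_iff_isUnit_det]
    exact IsUnit.of_mul_eq_one J.det (by rw [← det_mul, star_J_mul_J, det_one])
  have hstarJinv : (star J)⁻¹ = J := Matrix.inv_eq_right_inv star_J_mul_J
  have hYnorm : ‖(Y : Matrix (l ⊕ l) (l ⊕ l) ℂ)‖ = ‖(X : Matrix (l ⊕ l) (l ⊕ l) ℂ)‖ := by
    show ‖Y₀‖ = _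
    rw [hY₀, norm_neg]
    have hconj : star J * (X : Matrix (l ⊕ l) (l ⊕ l) ℂ)ᵀ * J = star J * (X : Matrix (l ⊕ l) (l ⊕ l) ℂ)ᵀ * (star J)⁻¹ := by
      rw [hstarJinv]
    have hskew : (star J * (X : Matrix (l ⊕ l) (l ⊕ l) ℂ)ᵀ * J)ᴴ = -(star J * (X : Matrix (l ⊕ l) (l ⊕ l) ℂ)ᵀ * J) := by
      rw [← star_eq_conjTranspose, star_mul, star_mul, star_star, hstarXT]
      simp only [Matrix.mul_neg, Matrix.neg_mul, Matrix.mul_assoc]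
    rw [norm_eq_of_spectrum_eq_of_skewHermitian hskew hXh]
    rw [hconj, spectrum_units_conj hJunit, spectrum_transpose]
  have hY : ‖Y‖ < Real.pi := by
    rw [← Submodule.norm_coe, hYnorm, Submodule.norm_coe]; exact hX
  -- `e^Y = u`
  have huT : uᵀ = J * star u * star J := by
    -- from `uᵀ J u = J`: `uᵀ = J u⁻¹ J⁻¹ = J u* J*`
    have h1 : uᵀ * J = J * star u := by
      calc uᵀ * J = uᵀ * J * (u * star u) := by rw [Matrix.mem_unitaryGroup_iff.1 huU, Matrix.mul_one]
        _ = (uᵀ * J * u) * star u := by simp only [Matrix.mul_assoc]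
        _ = J * star u := by rw [hu]
    calc uᵀ = uᵀ * J * star J := by rw [Matrix.mul_assoc, J_mul_star_J, Matrix.mul_one]
      _ = J * star u * star J := by rw [h1]
  have hexpY : exp (Y : Matrix (l ⊕ l) (l ⊕ l) ℂ) = u := by
    show exp Y₀ = u
    rw [hY₀, show -(star J * (X : Matrix (l ⊕ l) (l ⊕ l) ℂ)ᵀ * J) =
      star J * (-(X : Matrix (l ⊕ l) (l ⊕ l) ℂ)ᵀ) * (star J)⁻¹ by rw [hstarJinv, Matrix.mul_neg, Matrix.neg_mul],
      Matrix.exp_conj _ _ hJunit, Matrix.exp_neg, Matrix.exp_transpose, hXu, hstarJinv, huT]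
    -- `J* (J u* J*)⁻¹ J = u`
    have hinv : (J * star u * star J)⁻¹ = J * u * star J := by
      apply Matrix.inv_eq_right_inv
      calc J * star u * star J * (J * u * star J)
          = J * star u * (star J * J) * u * star J := by simp only [Matrix.mul_assoc]
        _ = J * (star u * u) * star J := by rw [star_J_mul_J, Matrix.mul_one]; simp only [Matrix.mul_assoc]
        _ = 1 := by rw [Matrix.mem_unitaryGroup_iff'.1 huU, Matrix.mul_one, J_mul_star_J]
    rw [hinv]
    calc star J * (J * u * star J) * J = (star J * J) * u * (star J * J) := by simp only [Matrix.mul_assoc]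
      _ = u := by rw [star_J_mul_J, Matrix.one_mul, Matrix.mul_one]
  -- injectivity of the `U(2n)` chart on the ball
  have hXY : (isChartRep_unitaryGroup (n := l ⊕ l)).expChart X = (isChartRep_unitaryGroup (n := l ⊕ l)).expChart Y := by
    apply Subtype.ext
    rw [coe_expChart, coe_expChart, hXu, hexpY]
  have h := injOn_expChart_ball_pi (mem_ball_zero_iff.2 hX) (mem_ball_zero_iff.2 hY) hXY
  have h' : (X : Matrix (l ⊕ l) (l ⊕ l) ℂ) = Y₀ := by
    have := congrArg (fun Z : (unitaryLogChart (l ⊕ l)).lie => (Z : Matrix (l ⊕ l) (l ⊕ l) ℂ)) h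
    exact this
  -- `X = −J* Xᵀ J` ⟹ `J X = −Xᵀ J`
  have hJX : J * (X : Matrix (l ⊕ l) (l ⊕ l) ℂ) = -((X : Matrix (l ⊕ l) (l ⊕ l) ℂ)ᵀ * J) := by
    conv_lhs => rw [h', hY₀]
    rw [Matrix.mul_neg]
    congr 1
    calc J * (star J * (X : Matrix (l ⊕ l) (l ⊕ l) ℂ)ᵀ * J) = (J * star J) * (X : Matrix (l ⊕ l) (l ⊕ l) ℂ)ᵀ * J := by
          simp only [Matrix.mul_assoc]
      _ = (X : Matrix (l ⊕ l) (l ⊕ l) ℂ)ᵀ * J := by rw [J_mul_star_J, Matrix.one_mul]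
  rw [hJX, neg_neg]

/-- For `u ∈ Sp(n) ≤ U(2n)`: `uᵀJu = J`. [cite: Sepanski2007, §1.1.4.3 (1.14)] -/
theorem transpose_mul_J_mul_of_mem {u : Matrix.unitaryGroup (l ⊕ l) ℂ} (hu : u ∈ symplecticSubgroup (Matrix.J l ℂ)) :
    (u : Matrix (l ⊕ l) (l ⊕ l) ℂ)ᵀ * Matrix.J l ℂ * (u : Matrix (l ⊕ l) (l ⊕ l) ℂ) = Matrix.J l ℂ :=
  mem_symplecticSubgroup_iff.1 hu

/-- **THE IMAGE OF THE MAXIMAL BALL: `Θ({A ∈ 𝔰𝔭(n) : ‖A‖ < π}) = {u ∈ Sp(n) : ‖u − 1‖ < 2}`** (`= {u : −1 ∉ σ(u)}`).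
`⊆`: gen 13; `⊇`: the principal logarithm of `u` is symplectic (`transpose_mul_J_eq_neg_of_exp_eq`), hence in
`𝔰𝔭(n) = symplecticLie J` (gen 12's `unitarySubgroupLogChart_lie_eq`). [cite: Balaban1985Averaging, (22)–(23) p. 21]
[cite: Helgason2000, Ch. I §1 Thm. 1.14 (13) p. 96] -/
theorem image_expChart_ball_pi_eq :
    (isChartRep_unitarySubgroup (symplecticSubgroup (Matrix.J l ℂ)) isClosed_symplecticSubgroup).expChart ''
        Metric.ball (0 : (unitarySubgroupLogChart (symplecticSubgroup (Matrix.J l ℂ)) isClosed_symplecticSubgroup).lie) Real.pi =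
      {g : symplecticSubgroup (Matrix.J l ℂ) |
        ‖(((g : symplecticSubgroup (Matrix.J l ℂ)) : Matrix.unitaryGroup (l ⊕ l) ℂ) : Matrix (l ⊕ l) (l ⊕ l) ℂ) - 1‖ < 2} := by
  refine Subset.antisymm (image_expChart_unitarySubgroup_ball_pi_subset _ _) ?_
  intro g hg
  have hg' : ((g : symplecticSubgroup (Matrix.J l ℂ)) : Matrix.unitaryGroup (l ⊕ l) ℂ) ∈
      (isChartRep_unitaryGroup (n := l ⊕ l)).expChart '' Metric.ball (0 : (unitaryLogChart (l ⊕ l)).lie) Real.pi := by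
    rw [image_expChart_ball_pi]; exact hg
  obtain ⟨X, hX, hXg⟩ := hg'
  rw [mem_ball_zero_iff] at hX
  have hXu : exp (X : Matrix (l ⊕ l) (l ⊕ l) ℂ) =
      (((g : symplecticSubgroup (Matrix.J l ℂ)) : Matrix.unitaryGroup (l ⊕ l) ℂ) : Matrix (l ⊕ l) (l ⊕ l) ℂ) := by
    rw [← coe_expChart X, hXg]
  have hXsp := transpose_mul_J_eq_neg_of_exp_eq hX (transpose_mul_J_mul_of_mem g.2)
    ((g : symplecticSubgroup (Matrix.J l ℂ)) : Matrix.unitaryGroup (l ⊕ l) ℂ).2 hXu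
  have hXh : (X : Matrix (l ⊕ l) (l ⊕ l) ℂ)ᴴ = -X := by
    rw [← star_eq_conjTranspose]; exact mem_unitaryLogChart_lie.1 X.2
  have hXmem : (X : Matrix (l ⊕ l) (l ⊕ l) ℂ) ∈
      (unitarySubgroupLogChart (symplecticSubgroup (Matrix.J l ℂ)) isClosed_symplecticSubgroup).lie := by
    rw [unitarySubgroupLogChart_lie_eq (Matrix.J_squared l ℂ)]
    exact mem_symplecticLie_iff.2 ⟨hXh, hXsp⟩
  refine ⟨⟨X, hXmem⟩, by rw [mem_ball_zero_iff]; exact hX, ?_⟩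
  apply (isChartRep_unitarySubgroup (symplecticSubgroup (Matrix.J l ℂ)) isClosed_symplecticSubgroup).injective
  rw [rho_expChart]
  exact hXu

variable (μ : Measure (symplecticSubgroup (Matrix.J l ℂ))) [μ.IsHaarMeasure]

/-- **`Θ({‖A‖ < π} ∩ 𝔰𝔭(n))` HAS FULL HAAR MEASURE IN `Sp(n)`**: `μ(Sp(n) ∖ Θ(B_π)) = 0`.
[cite: Helgason2000, Ch. I §1 Thm. 1.14 (13) p. 96] [cite: BrockerTomDieck1985, IV (2.11)] -/
theorem haar_compl_image_ball_pi_eq_zero :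
    μ ((isChartRep_unitarySubgroup (symplecticSubgroup (Matrix.J l ℂ)) isClosed_symplecticSubgroup).expChart ''
        Metric.ball (0 : (unitarySubgroupLogChart (symplecticSubgroup (Matrix.J l ℂ)) isClosed_symplecticSubgroup).lie) Real.pi)ᶜ = 0 := by
  have h := ae_norm_sub_one_lt_two (symplecticSubgroup (Matrix.J l ℂ)) isClosed_symplecticSubgroup μ expChart_symplectic_surjective
  rw [ae_iff] at h
  rw [image_expChart_ball_pi_eq]
  exact h

end Image

/-! ## §3 The global formula with the explicit density -/

section Global

variable [MeasurableSpace (unitarySubgroupLogChart (symplecticSubgroup (Matrix.J l ℂ)) isClosed_symplecticSubgroup).lie]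
  [BorelSpace (unitarySubgroupLogChart (symplecticSubgroup (Matrix.J l ℂ)) isClosed_symplecticSubgroup).lie]
  (η : Measure (unitarySubgroupLogChart (symplecticSubgroup (Matrix.J l ℂ)) isClosed_symplecticSubgroup).lie)
  [η.IsAddHaarMeasure] (μ : Measure (symplecticSubgroup (Matrix.J l ℂ))) [μ.IsHaarMeasure]

/-- **`μ = σ₀ • Θ_*(|det jac| dη|_{B_π})` on `Sp(n)`**, `σ₀` = the gen-12 window constant `μ(V_s)/ν_s(V_s)`
(`0 < s ≤ s_C`). [cite: Helgason2000, Ch. I §1 Thm. 1.14 (13) p. 96] [cite: Balaban1985UV3, p. 260] -/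
theorem haar_symplectic_eq_smul_chartMeasureOn {s : ℝ} (hs0 : 0 < s)
    (hs : s ≤ IsChartRep.chartRadius (unitarySubgroupLogChart (symplecticSubgroup (Matrix.J l ℂ)) isClosed_symplecticSubgroup)) :
    μ = (μ ((isChartRep_unitarySubgroup (symplecticSubgroup (Matrix.J l ℂ)) isClosed_symplecticSubgroup).window s) /
          (isChartRep_unitarySubgroup (symplecticSubgroup (Matrix.J l ℂ)) isClosed_symplecticSubgroup).chartMeasure
            (lie_adStable_unitarySubgroup (symplecticSubgroup (Matrix.J l ℂ)) isClosed_symplecticSubgroup) η s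
            ((isChartRep_unitarySubgroup (symplecticSubgroup (Matrix.J l ℂ)) isClosed_symplecticSubgroup).window s)) •
        (isChartRep_unitarySubgroup (symplecticSubgroup (Matrix.J l ℂ)) isClosed_symplecticSubgroup).chartMeasureOn
          (lie_adStable_unitarySubgroup (symplecticSubgroup (Matrix.J l ℂ)) isClosed_symplecticSubgroup) η (Metric.ball 0 Real.pi) := by
  haveI : CompactSpace (symplecticSubgroup (Matrix.J l ℂ)) := compactSpace_of_isClosed_subgroup _ isClosed_symplecticSubgroup
  exact (isChartRep_unitarySubgroup (symplecticSubgroup (Matrix.J l ℂ)) isClosed_symplecticSubgroup).haar_eq_smul_chartMeasureOn_of_null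
    (lie_adStable_unitarySubgroup (symplecticSubgroup (Matrix.J l ℂ)) isClosed_symplecticSubgroup) η μ hs0 hs
    measurableSet_ball (injOn_expChart_unitarySubgroup_ball_pi _ _) (haar_compl_image_ball_pi_eq_zero μ)

/-- **THE WINDOW CONSTANT IS `σ₀ = μ(Sp(n))/∫_{B_π} |det jac| dη`** for every `0 < s ≤ s_C` (print's «σ₀ = σ(0)» for the
gen-12 `Sp` statements). [cite: Balaban1985UV3, p. 260] [cite: Helgason2000, Ch. I §1 Thm. 1.14 (13) p. 96] -/
theorem windowConst_symplectic_eq {s : ℝ} (hs0 : 0 < s)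
    (hs : s ≤ IsChartRep.chartRadius (unitarySubgroupLogChart (symplecticSubgroup (Matrix.J l ℂ)) isClosed_symplecticSubgroup)) :
    μ ((isChartRep_unitarySubgroup (symplecticSubgroup (Matrix.J l ℂ)) isClosed_symplecticSubgroup).window s) /
          (isChartRep_unitarySubgroup (symplecticSubgroup (Matrix.J l ℂ)) isClosed_symplecticSubgroup).chartMeasure
            (lie_adStable_unitarySubgroup (symplecticSubgroup (Matrix.J l ℂ)) isClosed_symplecticSubgroup) η s
            ((isChartRep_unitarySubgroup (symplecticSubgroup (Matrix.J l ℂ)) isClosed_symplecticSubgroup).window s) =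
      μ Set.univ / ∫⁻ X in Metric.ball 0 Real.pi,
        jacDensity (lie_adStable_unitarySubgroup (symplecticSubgroup (Matrix.J l ℂ)) isClosed_symplecticSubgroup) X ∂η := by
  haveI : CompactSpace (symplecticSubgroup (Matrix.J l ℂ)) := compactSpace_of_isClosed_subgroup _ isClosed_symplecticSubgroup
  obtain ⟨huniv, hI0, hItop⟩ :=
    (isChartRep_unitarySubgroup (symplecticSubgroup (Matrix.J l ℂ)) isClosed_symplecticSubgroup).haar_univ_eq_of_null
      (lie_adStable_unitarySubgroup (symplecticSubgroup (Matrix.J l ℂ)) isClosed_symplecticSubgroup) η μ hs0 hs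
      measurableSet_ball (injOn_expChart_unitarySubgroup_ball_pi _ _) (haar_compl_image_ball_pi_eq_zero μ)
  rw [huniv, ENNReal.mul_div_cancel_right hI0 hItop]

/-- **HAAR MEASURE OF `Sp(n)` IN EXPONENTIAL COORDINATES, GLOBALLY: `∫_{Sp(n)} F dμ = (μ(Sp(n))/∫_{B_π} |det jac| dη) ·
∫_{‖A‖<π} F(e^A) |det((1 − e^{−adA})/adA)| dη(A)`** for EVERY measurable `F ≥ 0`, every Haar `μ` on `Sp(n)`, every
additive Haar `η` on `𝔰𝔭(n)`. [cite: Balaban1985UV3, p. 260] [cite: Helgason2000, Ch. I §1 Thm. 1.14 (13) p. 96] -/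
theorem lintegral_haar_symplectic_eq {F : symplecticSubgroup (Matrix.J l ℂ) → ℝ≥0∞} (hF : Measurable F) :
    ∫⁻ g, F g ∂μ =
      (μ Set.univ / ∫⁻ X in Metric.ball 0 Real.pi,
          jacDensity (lie_adStable_unitarySubgroup (symplecticSubgroup (Matrix.J l ℂ)) isClosed_symplecticSubgroup) X ∂η) *
        ∫⁻ X in Metric.ball 0 Real.pi,
          F ((isChartRep_unitarySubgroup (symplecticSubgroup (Matrix.J l ℂ)) isClosed_symplecticSubgroup).expChart X) *
            jacDensity (lie_adStable_unitarySubgroup (symplecticSubgroup (Matrix.J l ℂ)) isClosed_symplecticSubgroup) X ∂η := by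
  haveI : CompactSpace (symplecticSubgroup (Matrix.J l ℂ)) := compactSpace_of_isClosed_subgroup _ isClosed_symplecticSubgroup
  exact (isChartRep_unitarySubgroup (symplecticSubgroup (Matrix.J l ℂ)) isClosed_symplecticSubgroup).lintegral_haar_eq_of_null
    (lie_adStable_unitarySubgroup (symplecticSubgroup (Matrix.J l ℂ)) isClosed_symplecticSubgroup) η μ
    IsChartRep.chartRadius_pos le_rfl measurableSet_ball (injOn_expChart_unitarySubgroup_ball_pi _ _)
    (haar_compl_image_ball_pi_eq_zero μ) hF

/-- The same for Borel sets: `μ(B) = σ₀ · ∫_{A ∈ B_π, e^A ∈ B} |det jac| dη`.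
[cite: Balaban1985UV3, p. 260] [cite: Helgason2000, Ch. I §1 Thm. 1.14 (13) p. 96] -/
theorem haar_symplectic_apply_eq {B : Set (symplecticSubgroup (Matrix.J l ℂ))} (hB : MeasurableSet B) :
    μ B = (μ Set.univ / ∫⁻ X in Metric.ball 0 Real.pi,
          jacDensity (lie_adStable_unitarySubgroup (symplecticSubgroup (Matrix.J l ℂ)) isClosed_symplecticSubgroup) X ∂η) *
      ∫⁻ X in Metric.ball 0 Real.pi ∩
          (isChartRep_unitarySubgroup (symplecticSubgroup (Matrix.J l ℂ)) isClosed_symplecticSubgroup).expChart ⁻¹' B,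
        jacDensity (lie_adStable_unitarySubgroup (symplecticSubgroup (Matrix.J l ℂ)) isClosed_symplecticSubgroup) X ∂η := by
  haveI : CompactSpace (symplecticSubgroup (Matrix.J l ℂ)) := compactSpace_of_isClosed_subgroup _ isClosed_symplecticSubgroup
  rw [← lintegral_indicator_one hB, lintegral_haar_symplectic_eq η μ (measurable_one.indicator hB)]
  congr 1
  have hpre : MeasurableSet
      ((isChartRep_unitarySubgroup (symplecticSubgroup (Matrix.J l ℂ)) isClosed_symplecticSubgroup).expChart ⁻¹' B) :=
    (isChartRep_unitarySubgroup (symplecticSubgroup (Matrix.J l ℂ)) isClosed_symplecticSubgroup).measurable_expChart hB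
  rw [Set.inter_comm, ← Measure.restrict_restrict hpre, ← lintegral_indicator hpre]
  refine lintegral_congr fun X => ?_
  by_cases hX : (isChartRep_unitarySubgroup (symplecticSubgroup (Matrix.J l ℂ)) isClosed_symplecticSubgroup).expChart X ∈ B
  · rw [Set.indicator_of_mem hX, Pi.one_apply, one_mul, Set.indicator_of_mem (show X ∈ _ ⁻¹' B from hX)]
  · rw [Set.indicator_of_notMem hX, zero_mul, Set.indicator_of_notMem (show X ∉ _ ⁻¹' B from hX)]

/-- **EXPLICIT DENSITY, any unitary diagonalisation**: for every Haar `μ` on `Sp(n)`, every additive Haar `η` on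
`𝔰𝔭(n)`, every measurable `F ≥ 0` and any `A = U(A)·diag(iθ(A))·U(A)*` on `𝔰𝔭(n)`:
**`∫_{Sp(n)} F dμ = σ₀ ∫_{‖A‖<π} F(e^A) Π_{{j,k}} sinc((θ_j(A)+θ_k(A))/2) dη(A)`,
`σ₀ = μ(Sp(n))/∫_{‖A‖<π} Π_{{j,k}} sinc((θ_j(A)+θ_k(A))/2) dη(A)`** (unordered pairs `{j,k}` with repetition) —
[Balaban1985UV3] p. 260 for the symplectic series, on the whole group. [cite: Balaban1985UV3, p. 260]
[cite: Helgason2000, Ch. I §1 Thm. 1.14 (13) p. 96] [cite: Sepanski2007, §6.1.5.2] -/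
theorem lintegral_haar_symplectic_eq_prod_sinc_of_diag {F : symplecticSubgroup (Matrix.J l ℂ) → ℝ≥0∞} (hF : Measurable F)
    (U : (unitarySubgroupLogChart (symplecticSubgroup (Matrix.J l ℂ)) isClosed_symplecticSubgroup).lie →
      Matrix.unitaryGroup (l ⊕ l) ℂ)
    (θ : (unitarySubgroupLogChart (symplecticSubgroup (Matrix.J l ℂ)) isClosed_symplecticSubgroup).lie → l ⊕ l → ℝ)
    (hUθ : ∀ A : (unitarySubgroupLogChart (symplecticSubgroup (Matrix.J l ℂ)) isClosed_symplecticSubgroup).lie,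
      (A : Matrix (l ⊕ l) (l ⊕ l) ℂ) =
        (U A : Matrix (l ⊕ l) (l ⊕ l) ℂ) * diagonal (fun j => I * (θ A j : ℂ)) * star (U A : Matrix (l ⊕ l) (l ⊕ l) ℂ)) :
    ∫⁻ g, F g ∂μ =
      (μ Set.univ / ∫⁻ A in Metric.ball 0 Real.pi, ENNReal.ofReal (∏ p : Sym2 (l ⊕ l), Real.sinc (pairSum (θ A) p / 2)) ∂η) *
        ∫⁻ A in Metric.ball 0 Real.pi,
          F ((isChartRep_unitarySubgroup (symplecticSubgroup (Matrix.J l ℂ)) isClosed_symplecticSubgroup).expChart A) *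
            ENNReal.ofReal (∏ p : Sym2 (l ⊕ l), Real.sinc (pairSum (θ A) p / 2)) ∂η := by
  have hρ : ∀ A : (unitarySubgroupLogChart (symplecticSubgroup (Matrix.J l ℂ)) isClosed_symplecticSubgroup).lie,
      jacDensity (lie_adStable_unitarySubgroup (symplecticSubgroup (Matrix.J l ℂ)) isClosed_symplecticSubgroup) A =
        ENNReal.ofReal (∏ p : Sym2 (l ⊕ l), Real.sinc (pairSum (θ A) p / 2)) :=
    fun A => jacDensity_symplectic_J_eq_of_diag A (U A) (θ A) (hUθ A)
  have h := lintegral_haar_symplectic_eq η μ hF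
  simp only [hρ] at h
  exact h

/-- **EXPLICIT DENSITY, hypothesis-free**: `θ(A)` = the eigenvalues of the Hermitian matrix `−iA`;
`∫_{Sp(n)} F dμ = σ₀ ∫_{‖A‖<π} F(e^A) Π_{{j,k}} sinc((θ_j(A)+θ_k(A))/2) dη(A)`, `σ₀ = μ(Sp(n))/∫_{B_π} Π sinc dη`.
[cite: Balaban1985UV3, p. 260] [cite: Helgason2000, Ch. I §1 Thm. 1.14 (13) p. 96] -/
theorem lintegral_haar_symplectic_eq_prod_sinc {F : symplecticSubgroup (Matrix.J l ℂ) → ℝ≥0∞} (hF : Measurable F) :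
    ∫⁻ g, F g ∂μ =
      (μ Set.univ / ∫⁻ A in Metric.ball 0 Real.pi, ENNReal.ofReal (∏ p : Sym2 (l ⊕ l),
          Real.sinc (pairSum (isHermitian_neg_I_smul (conjTranspose_eq_neg_of_mem_lie A)).eigenvalues p / 2)) ∂η) *
        ∫⁻ A in Metric.ball 0 Real.pi,
          F ((isChartRep_unitarySubgroup (symplecticSubgroup (Matrix.J l ℂ)) isClosed_symplecticSubgroup).expChart A) *
            ENNReal.ofReal (∏ p : Sym2 (l ⊕ l),
              Real.sinc (pairSum (isHermitian_neg_I_smul (conjTranspose_eq_neg_of_mem_lie A)).eigenvalues p / 2)) ∂η :=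
  lintegral_haar_symplectic_eq_prod_sinc_of_diag η μ hF _ _
    fun A => eq_unitary_mul_diagonal_mul_star (conjTranspose_eq_neg_of_mem_lie A)

/-- **THE HAAR PROBABILITY MEASURE OF `Sp(n)` (print's normalised `dU′`): `∫ F dU = σ₀ ∫_{‖A‖<π} F(e^A) Π_{{j,k}}
sinc((θ_j+θ_k)/2) dη(A)`, `σ₀ = σ(0) = 1/∫_{‖A‖<π} Π_{{j,k}} sinc dη`**, on the whole group. [cite: Balaban1985UV3, p. 260]
[cite: Helgason2000, Ch. I §1 Thm. 1.14 (13) p. 96] -/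
theorem lintegral_haarProbability_symplectic_eq_prod_sinc [IsProbabilityMeasure μ] {F : symplecticSubgroup (Matrix.J l ℂ) → ℝ≥0∞}
    (hF : Measurable F) :
    ∫⁻ g, F g ∂μ =
      (∫⁻ A in Metric.ball 0 Real.pi, ENNReal.ofReal (∏ p : Sym2 (l ⊕ l),
          Real.sinc (pairSum (isHermitian_neg_I_smul (conjTranspose_eq_neg_of_mem_lie A)).eigenvalues p / 2)) ∂η)⁻¹ *
        ∫⁻ A in Metric.ball 0 Real.pi,
          F ((isChartRep_unitarySubgroup (symplecticSubgroup (Matrix.J l ℂ)) isClosed_symplecticSubgroup).expChart A) *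
            ENNReal.ofReal (∏ p : Sym2 (l ⊕ l),
              Real.sinc (pairSum (isHermitian_neg_I_smul (conjTranspose_eq_neg_of_mem_lie A)).eigenvalues p / 2)) ∂η := by
  rw [lintegral_haar_symplectic_eq_prod_sinc η μ hF, measure_univ, one_div]

end Global

end Literature.MathematicalPhysics.QuantumFieldTheory.Balaban1983to89.HaarDensitySymplecticGlobal

end
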